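import Summits.BirchSwinnertonDyer.BirchSwinnertonDyer.Theses.ResidualThetaTransportAtTwo
import Summits.BirchSwinnertonDyer.BirchSwinnertonDyer.Theorems.ThetaPartnerAtTwoSignedTransportAtTwoResidualFiniteness
import HarnessLib

/-!
# Route `ResidualThetaTransportAtTwo`, crux Kμ⁺ `SignedMuVanishingAtTwoPlus` (stmt-BirchSwinnertonDyer-20689):
# the ALGEBRAIC half at the RESIDUAL level — "X⁺ torsion with μ = 0" ⟺ "X⁺/2X⁺ finite", and the
# children 21438 (seed) / 21439 (propagation) from ONE residual statement each

Lead line `birth`, seat bsd-wall-rtt-p4 (helper; THEOREMS ONLY, every research input an inline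
hypothesis; nothing about any curve is asserted; BSD is not proved by this).

The algebraic conjunct of Kμ⁺ asks, for every signed `+` Selmer dual datum `D` of a habitat⁺ curve over
the cyclotomic `ℤ₂`-extension with `X = D.X` finitely generated over `Λ = ℤ₂⟦T⟧`, that `X` is
`Λ`-torsion with `μ(X) = 0`. By the kernel-checked `Λ`-algebra of the sibling route's lead
(`SignedTransportAtTwo.isTorsion_and_muInvariant_eq_zero_of_finite_quotient` /
`finite_quotient_of_muInvariant_eq_zero`, any `p`, file `ThetaPartnerAtTwoSignedTransportAtTwoResidualFiniteness`)
this is EQUIVALENT to the finiteness of the residual dual `X/2X` (Pontryagin-dually: `Sel⁺(W/ℚ_∞)[2]` finite)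
— the statement Greenberg–Vatsal (Thm. (1.4), p. 3) and B. D. Kim (Cor. 2.13) actually transport along
`E[p] ≅ E′[p]` (printed for odd `p`):
* `isTorsion_and_mu_eq_zero_iff_finite_quotient` — datum-wise equivalence (any number field, prime, sign);
* `signedMuPropagationAtTwo_of_residualTransfer` — child 21439 `SignedMuPropagationAtTwo` follows from the
  RESIDUAL TRANSFER «finiteness of `X⁺/2X⁺` passes from `A` to `W` along `W[2] ≃ A[2]`» (GV Prop. (2.8) /
  Kim Prop. 2.9–2.12 read at `2`; the sibling crux's registered `stub_fin2` shape, here for all good-supersingular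
  `a₂ = 0` pairs);
* `signedMuSeedAtTwoPlus_of_residualSeed` — child 21438 `SignedMuSeedAtTwoPlus` follows from a RESIDUAL SEED
  «some congruent good-supersingular `a₂ = 0` curve `A` has finite `X⁺(A)/2X⁺(A)`»;
* `muAlgebraic_of_residualFinite` / `residualFinite_of_muAlgebraic` — the algebraic conjunct of the crux on the
  habitat⁺ IS «`X⁺(W)/2X⁺(W)` finite for every finitely generated datum» (the line's reshaped stub
  `stub_signedResidualFiniteAtTwo`).
[cite: GreenbergVatsal2000, p. 3 (proof of Thm. (1.4)) and Prop. (2.8)] [cite: BDKim2009, Cor. 2.13]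
[cite: Washington1997, §13.2]
-/

set_option autoImplicit false
set_option linter.dupNamespace false

noncomputable section

open scoped Classical

open WeierstrassCurve Literature.NumberTheory.EllipticCurves Literature.NumberTheory.EllipticCurves.IwasawaAlgebra
  Literature.NumberTheory.EllipticCurves.Rank1Residual Literature.NumberTheory.EllipticCurves.Kobayashi2003
  Summit.BirchSwinnertonDyer.BirchSwinnertonDyer.Theses.ResidualThetaTransportAtTwo

namespace Summit.BirchSwinnertonDyer.BirchSwinnertonDyer.Theorems.SignedMuAtTwo

universe u

/-! ## §1. One datum: torsion ∧ μ = 0 ⟺ `X/pX` finite -/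

/-- **Datum-wise**: for a signed Selmer dual datum `D` with `X = D.X` finitely generated over `Λ`,
`X` is `Λ`-torsion with `μ(X) = 0` iff `X/pX` is finite (`D.mu = muInvariant p D.X` by definition).
[cite: GreenbergVatsal2000, p. 3 (proof of Thm. (1.4))] [cite: Washington1997, §13.2] -/
theorem isTorsion_and_mu_eq_zero_iff_finite_quotient {K : Type u} [Field K] [NumberField K] {p : ℕ}
    [Fact p.Prime] {W : WeierstrassCurve K} {κ : ZpExtension K p} {γ : Field.absoluteGaloisGroup K} {ε : ℤˣ}
    (D : SignedSelmerDualData W κ γ ε) [Module.Finite (IwasawaAlgebra p) D.X] :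
    (Module.IsTorsion (IwasawaAlgebra p) D.X ∧ D.mu = 0) ↔
      Finite (D.X ⧸ (augIdealP p • ⊤ : Submodule (IwasawaAlgebra p) D.X)) :=
  ⟨fun h ↦ SignedTransportAtTwo.finite_quotient_of_muInvariant_eq_zero h.1 h.2,
    fun h ↦ SignedTransportAtTwo.isTorsion_and_muInvariant_eq_zero_of_finite_quotient h⟩

/-! ## §2. Child 21439 (propagation) from the residual transfer -/

/-- **Residual transfer ⇒ `SignedMuPropagationAtTwo`** (child 21439): if, for good-supersingular `a₂ = 0`
curves `W, A` with `W[2] ≃ A[2]` Galois-equivariantly, finiteness of `X⁺/2X⁺` for every finitely generated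
datum of `A` gives finiteness of `X⁺/2X⁺` for every finitely generated datum of `W` (GV Prop. (2.8) / Kim
Prop. 2.9–2.12 read at `2`), then torsion with `μ = 0` propagates from `A` to `W`.
[cite: GreenbergVatsal2000, Thm. (1.4) and Prop. (2.8)] [cite: BDKim2009, Cor. 2.13] -/
theorem signedMuPropagationAtTwo_of_residualTransfer
    (hfin2 : ∀ (W : WeierstrassCurve ℚ) [W.IsElliptic] [W.IsGloballyMinimal] (A : WeierstrassCurve ℚ)
      [A.IsElliptic] [A.IsGloballyMinimal], GoodSS W 2 → W.frobeniusTrace 2 = 0 → GoodSS A 2 →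
      A.frobeniusTrace 2 = 0 →
      (∃ e : WeierstrassCurve.geomTorsion W (2 : ℤ) ≃+ WeierstrassCurve.geomTorsion A (2 : ℤ),
        ∀ (σ : Field.absoluteGaloisGroup ℚ) (P : WeierstrassCurve.geomTorsion W (2 : ℤ)), e (σ • P) = σ • e P) →
      ∀ (κ : ZpExtension ℚ 2) (γ : Field.absoluteGaloisGroup ℚ), κ.IsCyclotomic → κ.IsTopGenerator γ →
      (∀ (D' : SignedSelmerDualData A κ γ 1) [Module.Finite (IwasawaAlgebra 2) D'.X],
        Finite (D'.X ⧸ (augIdealP 2 • ⊤ : Submodule (IwasawaAlgebra 2) D'.X))) →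
      ∀ (D : SignedSelmerDualData W κ γ 1) [Module.Finite (IwasawaAlgebra 2) D.X],
        Finite (D.X ⧸ (augIdealP 2 • ⊤ : Submodule (IwasawaAlgebra 2) D.X))) :
    SignedMuPropagationAtTwo := by
  intro W _ _ A _ _ hssW haW hssA haA hiso hA κ γ hκ hγ D _
  have hA' : ∀ (D' : SignedSelmerDualData A κ γ 1) [Module.Finite (IwasawaAlgebra 2) D'.X],
      Finite (D'.X ⧸ (augIdealP 2 • ⊤ : Submodule (IwasawaAlgebra 2) D'.X)) :=
    fun D' _ ↦ (isTorsion_and_mu_eq_zero_iff_finite_quotient D').mp (hA κ γ hκ hγ D')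
  exact (isTorsion_and_mu_eq_zero_iff_finite_quotient D).mpr (hfin2 W A hssW haW hssA haA hiso κ γ hκ hγ hA' D)

/-! ## §3. Child 21438 (seed) from a residual seed -/

/-- **Residual seed ⇒ `SignedMuSeedAtTwoPlus`** (child 21438): if every habitat⁺ curve `W` is congruent mod `2`
to SOME good-supersingular `a₂ = 0` curve `A/ℚ` all of whose finitely generated `+` signed Selmer duals have
finite `X⁺/2X⁺`, then the μ-seed child holds. [cite: GreenbergVatsal2000, p. 3 (proof of Thm. (1.4))] -/
theorem signedMuSeedAtTwoPlus_of_residualSeed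
    (hseed : ∀ (W : WeierstrassCurve ℚ) [W.IsElliptic] [W.IsGloballyMinimal], ¬ W.HasCM → W.analyticRank = 0 →
      GoodSS W 2 → W.frobeniusTrace 2 = 0 → W.Δ < 0 →
      ∃ (A : WeierstrassCurve ℚ) (_ : A.IsElliptic) (_ : A.IsGloballyMinimal), GoodSS A 2 ∧ A.frobeniusTrace 2 = 0 ∧
        (∃ e : WeierstrassCurve.geomTorsion W (2 : ℤ) ≃+ WeierstrassCurve.geomTorsion A (2 : ℤ),
          ∀ (σ : Field.absoluteGaloisGroup ℚ) (P : WeierstrassCurve.geomTorsion W (2 : ℤ)), e (σ • P) = σ • e P) ∧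
        ∀ (κ : ZpExtension ℚ 2) (γ : Field.absoluteGaloisGroup ℚ), κ.IsCyclotomic → κ.IsTopGenerator γ →
          ∀ (D' : SignedSelmerDualData A κ γ 1) [Module.Finite (IwasawaAlgebra 2) D'.X],
            Finite (D'.X ⧸ (augIdealP 2 • ⊤ : Submodule (IwasawaAlgebra 2) D'.X))) :
    SignedMuSeedAtTwoPlus := by
  intro W _ _ hCM hr hss ha hΔ
  obtain ⟨A, hAell, hAmin, hssA, haA, hiso, hfinA⟩ := hseed W hCM hr hss ha hΔ
  exact ⟨A, hAell, hAmin, hssA, haA, hiso,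
    fun κ γ hκ hγ D' _ ↦ (isTorsion_and_mu_eq_zero_iff_finite_quotient D').mpr (hfinA κ γ hκ hγ D')⟩

/-! ## §4. The algebraic conjunct of Kμ⁺ on the habitat⁺ IS residual finiteness -/

/-- **Residual finiteness ⇒ the algebraic conjunct of Kμ⁺**: if `X⁺(W)/2X⁺(W)` is finite for every finitely
generated `+` datum of every habitat⁺ curve, then every such `X⁺(W)` is `Λ`-torsion with `μ = 0` (conjunct 1 of
`SignedMuVanishingAtTwoPlus`, i.e. the line's stub `MuAlgebraicZero`). [cite: GreenbergVatsal2000, p. 3 (proof of Thm. (1.4))] -/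
theorem muAlgebraic_of_residualFinite
    (hfin : ∀ (W : WeierstrassCurve ℚ) [W.IsElliptic] [W.IsGloballyMinimal], ¬ W.HasCM → W.analyticRank = 0 →
      GoodSS W 2 → W.frobeniusTrace 2 = 0 → W.Δ < 0 →
      ∀ (κ : ZpExtension ℚ 2) (γ : Field.absoluteGaloisGroup ℚ), κ.IsCyclotomic → κ.IsTopGenerator γ →
      ∀ (D : SignedSelmerDualData W κ γ 1) [Module.Finite (IwasawaAlgebra 2) D.X],
        Finite (D.X ⧸ (augIdealP 2 • ⊤ : Submodule (IwasawaAlgebra 2) D.X))) :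
    ∀ (W : WeierstrassCurve ℚ) [W.IsElliptic] [W.IsGloballyMinimal], ¬ W.HasCM → W.analyticRank = 0 →
      GoodSS W 2 → W.frobeniusTrace 2 = 0 → W.Δ < 0 →
      ∀ (κ : ZpExtension ℚ 2) (γ : Field.absoluteGaloisGroup ℚ), κ.IsCyclotomic → κ.IsTopGenerator γ →
      ∀ (D : SignedSelmerDualData W κ γ 1) [Module.Finite (IwasawaAlgebra 2) D.X],
        Module.IsTorsion (IwasawaAlgebra 2) D.X ∧ D.mu = 0 :=
  fun W _ _ hCM hr hss ha hΔ κ γ hκ hγ D _ ↦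
    (isTorsion_and_mu_eq_zero_iff_finite_quotient D).mpr (hfin W hCM hr hss ha hΔ κ γ hκ hγ D)

/-- **Conversely** the algebraic conjunct of Kμ⁺ gives residual finiteness; so the two are equivalent on the
habitat⁺. [cite: Washington1997, §13.2] -/
theorem residualFinite_of_muAlgebraic
    (halg : ∀ (W : WeierstrassCurve ℚ) [W.IsElliptic] [W.IsGloballyMinimal], ¬ W.HasCM → W.analyticRank = 0 →
      GoodSS W 2 → W.frobeniusTrace 2 = 0 → W.Δ < 0 →
      ∀ (κ : ZpExtension ℚ 2) (γ : Field.absoluteGaloisGroup ℚ), κ.IsCyclotomic → κ.IsTopGenerator γ →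
      ∀ (D : SignedSelmerDualData W κ γ 1) [Module.Finite (IwasawaAlgebra 2) D.X],
        Module.IsTorsion (IwasawaAlgebra 2) D.X ∧ D.mu = 0) :
    ∀ (W : WeierstrassCurve ℚ) [W.IsElliptic] [W.IsGloballyMinimal], ¬ W.HasCM → W.analyticRank = 0 →
      GoodSS W 2 → W.frobeniusTrace 2 = 0 → W.Δ < 0 →
      ∀ (κ : ZpExtension ℚ 2) (γ : Field.absoluteGaloisGroup ℚ), κ.IsCyclotomic → κ.IsTopGenerator γ →
      ∀ (D : SignedSelmerDualData W κ γ 1) [Module.Finite (IwasawaAlgebra 2) D.X],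
        Finite (D.X ⧸ (augIdealP 2 • ⊤ : Submodule (IwasawaAlgebra 2) D.X)) :=
  fun W _ _ hCM hr hss ha hΔ κ γ hκ hγ D _ ↦
    (isTorsion_and_mu_eq_zero_iff_finite_quotient D).mp (halg W hCM hr hss ha hΔ κ γ hκ hγ D)

/-- **The crux's algebraic conjunct, read from the parent**: `SignedMuVanishingAtTwoPlus` gives residual
finiteness of every finitely generated `+` datum on the habitat⁺ (used to certify that the reshaped stub
loses nothing). [cite: Washington1997, §13.2] -/
theorem residualFinite_of_signedMuVanishingAtTwoPlus (h : SignedMuVanishingAtTwoPlus) :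
    ∀ (W : WeierstrassCurve ℚ) [W.IsElliptic] [W.IsGloballyMinimal], ¬ W.HasCM → W.analyticRank = 0 →
      GoodSS W 2 → W.frobeniusTrace 2 = 0 → W.Δ < 0 →
      ∀ (κ : ZpExtension ℚ 2) (γ : Field.absoluteGaloisGroup ℚ), κ.IsCyclotomic → κ.IsTopGenerator γ →
      ∀ (D : SignedSelmerDualData W κ γ 1) [Module.Finite (IwasawaAlgebra 2) D.X],
        Finite (D.X ⧸ (augIdealP 2 • ⊤ : Submodule (IwasawaAlgebra 2) D.X)) :=
  residualFinite_of_muAlgebraic fun W _ _ hCM hr hss ha hΔ ↦ (h W hCM hr hss ha hΔ).1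

end Summit.BirchSwinnertonDyer.BirchSwinnertonDyer.Theorems.SignedMuAtTwo

end
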